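import Mathlib
import Summits.CriticalPhenomena.PercolationContinuityZ3.Theorems.PinholeClosing.Negative.PinholeClosingBaseline
import Literature.Probability.Percolation.MinOpenCut
import HarnessLib

/-!
# Crux `PercBudgetLadder.PinholeClosing` (stmt-CriticalPhenomena-5249), line `balanced-deletion` — stub `stub_budgetMeasurable`

Helper file for the crux skeleton `Cruxes/PinholeClosing/Lines/balanced_deletion.lean`
(lead prover-line-stmt-CriticalPhenomena-5249-c1-0); proves exactly the registered stub
`stub_budgetMeasurable` of that skeleton (`--supports stmt-CriticalPhenomena-5249`), one namespace down as
`Summit.CriticalPhenomena.PercolationContinuityZ3.Theorems.BalancedDeletion.stub_budgetMeasurable`.  No new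
definitions: the statement is in the tree's vocabulary (`minOpenCutIn`, `box`, `innerBoundary`, `zdGraph`,
`BondConfig`).

Informal statement (MEASURABILITY OF THE BUDGET).  For the window `(n, m)` the min-cut budget
`ω ↦ MinCut(n, m)(ω) = minOpenCutIn ↑(box 3 m) ↑(box 3 n) ↑(∂ⁱⁿ box 3 m) ω ∈ ℕ∞` is a measurable map on
`BondConfig (Site 3)` (product σ-algebra) into `ℕ∞` (discrete σ-algebra).

Proof route.  `ℕ∞` is countable with measurable singletons, so it suffices that every fibre over a natural
number is measurable (`ENat.measurable_iff`; the fibre of `⊤` is the complement of their countable union).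
The fibre `{MinCut = 0}` is `{MinCut ≤ 0}` and `{MinCut = j+1} = {MinCut ≤ j+1} ∖ {MinCut ≤ j}`
(`ENat.coe_add_one_le_iff`), and each sub-level event `{MinCut ≤ k}` of a FINITE region is a cylinder
event, hence measurable (`measurableSet_setOf_minOpenCutIn_le`, `MinOpenCut.lean`; Grimmett,
*Percolation* (1999), §2.2).  The region `↑(box 3 m)` is finite (`Finset.finite_toSet`).
-/

noncomputable section

namespace Summit.CriticalPhenomena.PercolationContinuityZ3.Theorems

open MeasureTheory
open Literature.Probability.Percolation Literature.Probability.LatticeModels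
open Summit.CriticalPhenomena.PercolationContinuityZ3.Theorems.PinholeClosing.Negative

namespace BalancedDeletion

namespace BudgetMeasurable

variable {V : Type*}

-- adapted from Theorems/PercBudgetLadderBudgetTightnessStubFloor.lean (`integrable_toNat_minOpenCutIn`)
/-- **Measurability of the min-cut budget of a finite region**: for finite `S`, the map
`ω ↦ MinCut_S(A, B)(ω) ∈ ℕ∞` is measurable — its fibres over `ℕ` are differences of the cylinder events
`{MinCut ≤ k}` (`measurableSet_setOf_minOpenCutIn_le`), and `ℕ∞` is discrete (`ENat.measurable_iff`).
[folklore] -/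
theorem measurable_minOpenCutIn {S : Set V} (hS : S.Finite) (A B : Set V) :
    Measurable fun ω : BondConfig V => minOpenCutIn S A B ω := by
  have hle := measurableSet_setOf_minOpenCutIn_le hS A B
  refine ENat.measurable_iff.2 fun j => ?_
  cases j with
  | zero =>
    convert hle 0 using 1
    ext ω
    simp
  | succ j =>
    convert (hle (j + 1)).diff (hle j) using 1
    ext ω
    simp only [Set.mem_preimage, Set.mem_singleton_iff, Set.mem_sdiff, Set.mem_setOf_eq,
      not_le, Nat.cast_succ, le_antisymm_iff, ENat.coe_add_one_le_iff]

end BudgetMeasurable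

/-- **Stub 3 of line `balanced-deletion` (measurability of the budget).**  For every window `(n, m)` the
min-cut budget `ω ↦ minOpenCutIn ↑(box 3 m) ↑(box 3 n) ↑(innerBoundary (zdGraph 3) (box 3 m)) ω ∈ ℕ∞` is
measurable (`BudgetMeasurable.measurable_minOpenCutIn` with the finite region `↑(box 3 m)`). [folklore] -/
theorem stub_budgetMeasurable :
    ∀ (n m : ℕ), Measurable (fun ω : BondConfig (Site 3) =>
      minOpenCutIn (↑(box 3 m) : Set (Site 3)) (↑(box 3 n) : Set (Site 3)) (↑(innerBoundary (zdGraph 3) (box 3 m)) : Set (Site 3)) ω) :=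
  fun n m => BudgetMeasurable.measurable_minOpenCutIn (box 3 m).finite_toSet
    (↑(box 3 n) : Set (Site 3)) (↑(innerBoundary (zdGraph 3) (box 3 m)) : Set (Site 3))

end BalancedDeletion

end Summit.CriticalPhenomena.PercolationContinuityZ3.Theorems
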